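import Summits.ResolutionOfSingularities.ResolutionOfSingularities.Theorems.HilbertSamuelEliminationSigmaMaxModificationsCorridor3WLadderMovingIsoDefs
import Mathlib.RingTheory.MvPowerSeries.Substitution
import Mathlib.AlgebraicGeometry.ResidueField
import HarnessLib

/-!
# [OURS · L1 W4.2] MODULE `Corridor3WLadderIsoProximity` (crux chain w42, idea-1 ROUND 6 Sketch C5 «proximity trichotomy + arc osculation»)
# — part 1/2: the DEFINITIONS (arc-divisibility rows; satellite / rational / inseparable steps of an isolated point tower; the rows
# K1 / K2 / K3, (k2) and the separable-restricted rows)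

PROVENANCE / SPLIT FOR THE GATE (typer res-type-012; res-L1-w42-plan-1 RULINGS v3.12-3 (O) «D14 … landing path (i) Sketch C5 §1–§2 defs as
a Defs file (typer pass by lead-1 or 012)», res-L1-w42-lead-1 2026-08-27T08:48:04Z «to res-type-012: YES — please take the Defs typer pass of
Sketch C5»): the two tree modules `…Corridor3WLadderIsoProximityDefs` (this file: every DEFINITION of the sketch, in order) and
`…Corridor3WLadderIsoProximity` (the PROVED glue theorems) land res-L1-w42-idea-1's (gen 6) `HOME/L/res-L1-w42-idea-1/Sketch-L1-idea-1-C5.lean`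
(sha16 `d9de4647629be5a3`, 250 l.; farm `lean check` rc 0 · 0 errors · 0 sorries) with every declaration BYTE-IDENTICAL and in the SAME namespace
`…Cruxes.SigmaMaxModifications.IdeasL1C5`, written against the LANDED `…Corridor3WLadderMovingIsoDefs` (res-type-012, p500943: `IsIsoPointTower`,
`IsoQuadraticTowerTerminates`) and Mathlib (`MvPowerSeries.subst`, `Scheme.Hom.residueFieldMap`) — nothing is re-declared.  Differences from the
sketch: (i) definitions hoisted into this `…Defs` module, the seven proved theorems into part 2/2; (ii) provenance tags added to the docstrings
that had none (statements untouched).  All `def`s are parametrised `Prop`-valued OURS rows / carriers (or plain substitution data), consumed BY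
NAME only — D14's `isoFreeRationalTailsImpossible_holds (p) : IsoFreeRationalTailsImpossible p 3` (res-L1-w42-lead-1) closes K1 against THIS
statement; cited works are POINTERS; NOT statements of [CossartPiltant2009], [CossartJannsenSaito2020] nor of the manuscript [Hironaka2017] under
review in the cell; card C5 = SURVIVES-MODULO ⟨K2⟩ ∧ ⟨K3⟩, K1 printable (tri-2 TRIAGE-r7), helper VOCABULARY counted 0.  AI typing, weaker than
expert review.  idea-1's module docstring follows unchanged.
-/

/-!
# [OURS · L1 W4.2 · IDEATOR 1, ROUND 6] Sketch C5 — «PROXIMITY TRICHOTOMY + ARC OSCULATION» on the isolated kernel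
# `IsoQuadraticTowerTerminates p 3` (its translation-recurrent residual T3 of card C4)

OURS (cell res-hironaka, slot ★L-G4 W4.2, crux chain w42, ideator res-L1-w42-idea-1 gen 6); NOT statements of the manuscript
[Hironaka2017] (unused) nor of [CossartJannsenSaito2020] / [CossartPiltant2009]; AI-drafted, weaker than expert review.
Nothing here is registered on stmt-…-19249: vocabulary + ONE proved glue theorem + typed first lemmas (no `sorry`).

## The idea in one paragraph

Classify each step `X_{n+1} → X_n` of an isolated E3 point tower (`IsIsoPointTower`, p500943) INTRINSICALLY — no frame, no
polyhedron — by the two incidences print uses for infinitely near points (Enriques–Zariski PROXIMITY; Cossart–Piltant's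
quadratic sequences [CossartPiltant2009, ch. 3 I.9–I.11, ch. 4 II.4]):
* JUMP: `κ(x_n) → κ(x_{n+1})` is not onto (a residue-degree jump);
* SATELLITE: `x_{n+2}` lies on the strict transform `π*E_{n+1} − E_{n+2}` of the exceptional (Cartier) divisor `E_{n+1} = π_n⁻¹(x_n)`
  created one step earlier (`x_{n+2}` is PROXIMATE to `x_n`; typed stalk-locally: `𝔪_{x_n}𝒪_{x_{n+2}} ≠ 𝔪_{x_{n+1}}𝒪_{x_{n+2}}`);
* FREE-RATIONAL: neither.
An eventually free-rational tail `x_{n₀} ← x_{n₀+1} ← ⋯` is the sequence of infinitely near points of a SMOOTH FORMAL ARC `C`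
through `x_{n₀}` (all later points sit in the iterated `t`-charts of one parameter `t`), and constancy of the Hilbert–Samuel
function along it forces `C ⊂ X_{n₀}(ν)^` formally — for a hypersurface `h` of order `m` this is the divisibility
`t^{nm} ∣ h(t, t^n y, t^n v, t^n w) ∀ n ⇒ h ∈ (y, v, w)^m` (§1); in general it is Bennett/CJS normal flatness read on a standard
base.  At an ISOLATED point of `X(ν)` no such formal arc exists (excellence: the stratum of the completion is the completion of
the stratum).  Hence (K1, provable now) every isolated tower has infinitely many jumps or infinitely many satellite steps; the
residual cruxes are K2 «jump-recurrent towers are impossible» (a residue jump of degree `d` divides the transverse polyhedral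
invariants — Cossart–Piltant ch. 3 I.8.3(ix) «x′ not rational over x ⇒ β(x′) < 1») and K3 «satellite-recurrent towers are
impossible» (at a satellite step two exceptional hyperplanes through the point are CANONICAL coordinates and the translation
freedom drops to one direction; the exceptional exponents stay `< m` by isolation) — technique A in an intrinsic frame.
§2 types the trichotomy over `BlowupTower` and PROVES the glue `K1 → K2 → K3 → IsoQuadraticTowerTerminates p N`.
§3 makes plan-1's three-way cover of RULINGS v3.12-1 (F) intrinsic: the stage token `IsInsepStage` (`e < ē`, on the tree's
`Scheme.dirDim`/`Scheme.geomDirDim`), (k2) `IsoInsepTowerTerminates p N`, the separable-restricted rows, and the PROVED joins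
`isoQuadraticTowerTerminates_of_four` / `_of_three` (K1 + (k2) + jumps/satellites on eventually-separable towers ⇒ kernel).

References: [CossartPiltant2009] V. Cossart, O. Piltant, J. Algebra 321 (2009) 1836–1976, ch. 3 I.9–I.11 (formal curve
`C = V(X̂, û₂, û₃) ⊂ Σ_p`), I.8.3(ix); [CossartJannsenSaito2020] LNM 2270 Thm. 3.3 (Bennett), Def. 6.34; Enriques–Chisini /
Zariski proximity (Casas-Alvero, *Singularities of plane curves*, LMS LN 276, ch. 3–4) for the words «free / satellite».
-/

noncomputable section

-- cell module setting (namespace `Summit.ResolutionOfSingularities.ResolutionOfSingularities.…` re-enters the summit name)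
set_option linter.dupNamespace false

open CategoryTheory AlgebraicGeometry TopologicalSpace IsLocalRing
open Summit.ResolutionOfSingularities.ResolutionOfSingularities.Theorems.CampaignW42
open Summit.ResolutionOfSingularities.ResolutionOfSingularities.Theorems.SigmaMaxModificationsCorridor3.Moving
open Literature.AlgebraicGeometry.Resolution Literature.AlgebraicGeometry.CossartJannsenSaito2020
open Summit.ResolutionOfSingularities.ResolutionOfSingularities.Cruxes.SigmaMaxModifications.IdeasL1Idea2R4
  (IsIsoPointTower IsoQuadraticTowerTerminates)

namespace Summit.ResolutionOfSingularities.ResolutionOfSingularities.Cruxes.SigmaMaxModifications.IdeasL1C5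

universe u

/-! ## §1. The arc-divisibility lemma (algebraic heart of K1), typed in two strengths -/

section Algebra

open MvPolynomial

/-- The `n`-th iterated `t`-chart substitution `t ↦ t`, `y_i ↦ tⁿ·y_i` (`i = 1, 2, 3`) on `K[t, y₁, y₂, y₃]` (index `0` = `t`). [folklore] -/
def chartSubst (K : Type u) [CommRing K] (n : ℕ) : Fin 4 → MvPolynomial (Fin 4) K :=
  fun i => if i = 0 then X 0 else X 0 ^ n * X i

/-- [OURS · L1 W4.2 · C5 §1] **ARC DIVISIBILITY, polynomial strength.** If the total transform of `h` at the `n`-th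
infinitely near point of the arc `{y₁ = y₂ = y₃ = 0}` is divisible by `t^{n·m}` for EVERY `n` (i.e. the strict transforms keep
order `m` at all these points), then `h ∈ (y₁, y₂, y₃)^m`: the arc lies in the multiplicity-`m` locus.  (Proof on paper:
the substitution is injective on monomials, so each monomial `t^a y^b` with `|b| < m` needs `a ≥ n(m − |b|) ≥ n` for all `n`.)
First checkable step of the card; M⁻. [folklore] -/
def ArcDivisibilityPoly (K : Type u) [CommRing K] (m : ℕ) : Prop :=
  ∀ h : MvPolynomial (Fin 4) K,
    (∀ n : ℕ, X 0 ^ (n * m) ∣ bind₁ (chartSubst K n) h) →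
      h ∈ (Ideal.span ({X 1, X 2, X 3} : Set (MvPolynomial (Fin 4) K))) ^ m

/-- The same substitution on formal power series `K⟦t, y₁, y₂, y₃⟧` (Mathlib `MvPowerSeries.subst`; the constant
coefficients vanish, so `HasSubst` holds). [folklore] -/
def chartSubstSeries (K : Type u) [CommRing K] (n : ℕ) : Fin 4 → MvPowerSeries (Fin 4) K :=
  fun i => if i = 0 then MvPowerSeries.X 0 else MvPowerSeries.X 0 ^ n * MvPowerSeries.X i

/-- [OURS · L1 W4.2 · C5 §1] **ARC DIVISIBILITY, formal strength** (the form K1 consumes after Cohen presentation of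
`𝒪̂_{X_{n₀}, x_{n₀}}` and straightening the osculating arc to `{y = 0}`): `t^{n m} ∣ h(t, tⁿy)` for all `n` forces
`h ∈ (y₁, y₂, y₃)^m` in `K⟦t, y⟧`.  M⁻ (coefficientwise, as in the polynomial case). [folklore] -/
def ArcDivisibilitySeries (K : Type u) [CommRing K] (m : ℕ) : Prop :=
  ∀ h : MvPowerSeries (Fin 4) K,
    (∀ n : ℕ, MvPowerSeries.X 0 ^ (n * m) ∣ MvPowerSeries.subst (chartSubstSeries K n) h) →
      h ∈ (Ideal.span ({MvPowerSeries.X 1, MvPowerSeries.X 2, MvPowerSeries.X 3} :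
        Set (MvPowerSeries (Fin 4) K))) ^ m

end Algebra

/-! ## §2. The proximity trichotomy of an isolated point tower (the rows; the PROVED glue is part 2/2) -/

/-- [OURS · C5] **SATELLITE step** (Enriques–Zariski proximity, DIVISOR-LEVEL): `x_{n+2}` lies on the strict transform
`π_{n+1}^* E_{n+1} − E_{n+2}` of the exceptional Cartier divisor `E_{n+1} = π_n⁻¹(x_n)` (ideal `𝔪_{x_n}·𝒪_{X_{n+1}}`), i.e.
`x_{n+2}` is proximate to `x_n`.  Typed stalk-locally and chart-free: the pulled-back OLD exceptional ideal
`𝔪_{x_n}·𝒪_{X_{n+2},x_{n+2}}` is strictly smaller than the NEW one `𝔪_{x_{n+1}}·𝒪_{X_{n+2},x_{n+2}}` (in the `t`-chart, `t` a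
local equation of `E_{n+1}` at `x_{n+1}`, both are `(t)`; off it they are `(w·t′) ⊊ (w)`).  Its negation («free w.r.t. the last
divisor») is exactly «`x_{n+2}` lies in the `t`-chart», equivalently «the initial form of `t` does not vanish at the direction
`x_{n+2}`» — the form the arc lemma consumes.  (The set-level strict transform of `(E_{n+1})_red` is NOT the right notion: after a
wild regeneration `in h′ = (Y′ + U₂′)^p` its tangent plane meets `ℙ(Dir)` in a point, not in the line `{U₁ = 0}`.) [folklore] -/
def IsSatelliteStep (T : BlowupTower.{u}) (pt : ∀ n, T.X n) (n : ℕ) : Prop :=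
  Ideal.map ((T.π (n + 1) ≫ T.π n).stalkMap (pt (n + 2))).hom (maximalIdeal _) ≠
    Ideal.map ((T.π (n + 1)).stalkMap (pt (n + 2))).hom (maximalIdeal _)

/-- [OURS · C5] **RATIONAL step**: the residue field does not grow, `κ(x_n) → κ(x_{n+1})` onto (Mathlib
`Scheme.Hom.residueFieldMap`).  Its negation is a residue-degree JUMP. [folklore] -/
def IsRationalStep (T : BlowupTower.{u}) (pt : ∀ n, T.X n) (n : ℕ) : Prop :=
  Function.Surjective ((T.π n).residueFieldMap (pt (n + 1))).hom

/-- [OURS · L1 W4.2 · C5] **K1 — FREE-RATIONAL TAILS ARE IMPOSSIBLE** (M; the arc lemma): over a maximal origin of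
characteristic `p` at level `N`, no isolated E3 point tower is eventually free-rational (from some `n₀` on every step is
rational and no step is satellite).  Mechanism: such a tail is the sequence of infinitely near points of a smooth formal arc
`C` through `x_{n₀}`; `H = ν` along it forces `C ⊂ X_{n₀}(ν)^` (§1 for hypersurfaces; Bennett + `u`-standard bases in
general), contradicting `IsIsolatedInHSMaxLocus` at `x_{n₀}` (excellence).  Why it might fail: only the general
(non-hypersurface, `edim ≥ 5`) transfer «order kept on a standard base at all free infinitely near points ⇒ normally flat
along the arc» — the hypersurface case is §1.  [cite: CossartPiltant2009, ch. 3 I.9 (formal curve in `Σ_p`)] -/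
def IsoFreeRationalTailsImpossible (p N : ℕ) : Prop :=
  ∀ (ν : ℕ → ℕ) (T : BlowupTower.{u}) (pt : ∀ n, T.X n), IsMaximalOrigin p N ν (T.X 0) (pt 0) →
    IsIsoPointTower N ν T pt → ¬ ∃ n₀, ∀ n, n₀ ≤ n → IsRationalStep T pt n ∧ ¬ IsSatelliteStep T pt n

/-- [OURS · L1 W4.2 · C5] **K2 — JUMP-RECURRENT TOWERS ARE IMPOSSIBLE** (crux; technique A): no isolated E3 point tower over a
maximal origin has infinitely many residue-degree jumps.  Lever: a near point of residue degree `d ≥ 2` over `κ(x_n)` is cut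
out by an irreducible polynomial of degree `d` in a transverse parameter, which divides the transverse coordinates of the
characteristic polyhedron by `d` (Cossart–Piltant ch. 3 I.8.3(ix): «x′ not rational over x ⇒ β(x′) < 1»); with `δ ∈ (1,2)`
forced by isolation, jumps cannot recur.  Why it might fail: purely inseparable jumps of degree `p` (imperfect `κ`, CP's
«x′ inseparable over x», the (Dis) case `ω = p = 2`) do not divide the polyhedron the same way.
[cite: CossartPiltant2009, ch. 3 I.8.3 (ix), I.10 (Dis)] -/
def IsoJumpRecurrentImpossible (p N : ℕ) : Prop :=
  ∀ (ν : ℕ → ℕ) (T : BlowupTower.{u}) (pt : ∀ n, T.X n), IsMaximalOrigin p N ν (T.X 0) (pt 0) →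
    IsIsoPointTower N ν T pt → ¬ ∀ n₀, ∃ n, n₀ ≤ n ∧ ¬ IsRationalStep T pt n

/-- [OURS · L1 W4.2 · C5] **K3 — SATELLITE-RECURRENT TOWERS ARE IMPOSSIBLE** (crux; the honest residual; technique A in an
INTRINSIC frame): no isolated E3 point tower over a maximal origin has infinitely many satellite steps.  At a satellite stage
the two most recent exceptional hyperplanes through the point are canonical parameters `(t′, w)`, the point cannot translate
in the `t′`-direction, the exceptional exponents stay `< m` (isolation), and vertex-only tails are card C4's forced Hironaka
game; what must be supplied is the substitute for Cossart–Piltant's Archimedean step («`μ(u₁) − i·μ(u₂) ≥ 0` for all `i` is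
absurd») for towers that are proximate to ever older points.  Why it might fail: this class contains every tower that is the
quadratic sequence of a rank-2 / irrational-slope valuation; no specimen of record.
[cite: CossartPiltant2009, ch. 3 I.3 case (v), II.7; ch. 4 II.4] -/
def IsoSatelliteRecurrentImpossible (p N : ℕ) : Prop :=
  ∀ (ν : ℕ → ℕ) (T : BlowupTower.{u}) (pt : ∀ n, T.X n), IsMaximalOrigin p N ν (T.X 0) (pt 0) →
    IsIsoPointTower N ν T pt → ¬ ∀ n₀, ∃ n, n₀ ≤ n ∧ IsSatelliteStep T pt n

/-! ## §3  The kernel's THREE-WAY COVER of RULINGS v3.12-1 (F), made intrinsic (plan-1 08:12:41Z: (k1) separable vertex ·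
(k2) `T3insep` · (k3) `T3trans` «idea-1 gives it an intrinsic formulation»).  The scope token is the stage predicate `e < ē`
(inseparable directrix, CJS Def. 2.26, tree `Scheme.dirDim` / `Scheme.geomDirDim`); the cover is: inseparable stages recur (k2), or the
tower is eventually separable and then the proximity trichotomy of §2 applies to its tail.  All joins PROVED; nothing here is frame- or
chart-dependent (tri-1's O2 caveat 08:02:39Z: vertex/translation type read off charts is a FRAME property — proximity and `e < ē` are not). -/

/-- [OURS · C5] Stage `n` of the tower has an INSEPARABLE directrix at the marked point: `e_{x_n} < ē_{x_n}` (the token `InsepDirAt`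
of IDEAS §G/§7, typed on the tree's `Scheme.dirDim` / `Scheme.geomDirDim`; e.g. `in = x³ + λy³` over `𝔽₃(λ)`, tri-1's F23b).
[cite: CossartJannsenSaito2020, Def. 2.26 (pointer)] -/
def IsInsepStage (T : BlowupTower.{u}) (pt : ∀ n, T.X n) (n : ℕ) : Prop :=
  @Scheme.dirDim (T.X n) (T.ln n) (pt n) < @Scheme.geomDirDim (T.X n) (T.ln n) (pt n)

/-- [OURS · C5 · (k2) `T3insep`] **`IsoInsepTowerTerminates p N`**: no isolated point tower from a maximal reduced origin has
inseparable-directrix stages INFINITELY OFTEN (a fortiori: no iso tower with `e < ē` at every stage — F23b-type towers terminate).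
Candidate owner per RULINGS v3.12-1 (F): the `Iso`-restriction of the `(2,3)`-cell programme (`Cell23`, p510352).  Why it might fail:
this is the class of the Hironaka–Mizutani origins and of CP's `(Dis)`/p-th-power-residue case; no termination mechanism of record.
OURS row; not a citation of print. [cite: CossartPiltant2009, ch. 3 I.10 (Dis) (pointer)] -/
def IsoInsepTowerTerminates (p N : ℕ) : Prop :=
  ∀ (ν : ℕ → ℕ) (T : BlowupTower.{u}) (pt : ∀ n, T.X n), IsMaximalOrigin p N ν (T.X 0) (pt 0) →
    IsIsoPointTower N ν T pt → ¬ ∀ n₀, ∃ n, n₀ ≤ n ∧ IsInsepStage T pt n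

/-- [OURS · C5 · (k1)/(k3) refined] jump-recurrence is impossible on EVENTUALLY SEPARABLE isolated towers.  OURS row; not a citation of
print. [cite: CossartPiltant2009, ch. 3 I.8.3 (ix) (pointer)] -/
def IsoSepJumpRecurrentImpossible (p N : ℕ) : Prop :=
  ∀ (ν : ℕ → ℕ) (T : BlowupTower.{u}) (pt : ∀ n, T.X n), IsMaximalOrigin p N ν (T.X 0) (pt 0) →
    IsIsoPointTower N ν T pt → (∃ n₀, ∀ n, n₀ ≤ n → ¬ IsInsepStage T pt n) → ¬ ∀ n₀, ∃ n, n₀ ≤ n ∧ ¬ IsRationalStep T pt n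

/-- [OURS · C5 · (k1)/(k3) refined] satellite-recurrence is impossible on EVENTUALLY SEPARABLE isolated towers (contains C4's
separable vertex towers (k1) with infinitely many chart-letter changes; same-letter runs are free steps and fall under K1).  OURS row; not a
citation of print. [cite: CossartPiltant2009, ch. 4 II.4 (pointer)] -/
def IsoSepSatelliteRecurrentImpossible (p N : ℕ) : Prop :=
  ∀ (ν : ℕ → ℕ) (T : BlowupTower.{u}) (pt : ∀ n, T.X n), IsMaximalOrigin p N ν (T.X 0) (pt 0) →
    IsIsoPointTower N ν T pt → (∃ n₀, ∀ n, n₀ ≤ n → ¬ IsInsepStage T pt n) → ¬ ∀ n₀, ∃ n, n₀ ≤ n ∧ IsSatelliteStep T pt n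

end Summit.ResolutionOfSingularities.ResolutionOfSingularities.Cruxes.SigmaMaxModifications.IdeasL1C5

end
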